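/-
Copyright (c) 2026 the pub-hodgecm-mathlib formalisation cell (harness21).  Prover seat hodgecm-mathlib-LH4-p07 (g9), req620 Track A «(D-RAM) FOUR-FRAME» squad
(STAGE-1b, row-(2) lineage; dealer LH4-plan (g13) WORD #58 RULING A ∕ #59 ∕ #64 ∕ #65: owner of the two-literal census law of `lev_{a,m}`, RamK lane), 2026-09-04.
-/
import Summits.HodgeConjecture.HodgeConjecture.Theorems.F0P3cDyRamToricCensusSumRamKCut   -- ★ p859753 (this seat): `filter_band_eq_Ioc` (the cut top band as an interval)
import Summits.HodgeConjecture.HodgeConjecture.Theorems.F0P3cDyRamStageOneBDefs          -- ★ p859562 (dealer): `csOfRecord`, `klOfRecord`, `blOfRecord` (D-1b exponents); brings `mstarOfRecord`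
import HarnessLib

/-!
# Crux `H413`, line LH4 «(D-RAM) FOUR-FRAME» — STAGE-1b, row (2): (LAW-arith)-RamK «THE CLOSING ARITHMETIC OF THE LEVEL-PIECE CENSUS LAW, TYPE RamK»
# `(q − 1)·q^{ks}·W(m₁, jl₁, C) = 2q^m(q^{(jl−d)∕2+1} − q^{shiftR d + bs})` for the three pieces of record, and the `(cA, cB)` template

Cell `hodgecm-mathlib` (D-0151), FLOOR 0, crux item H413 = `stmt-HodgeConjecture-24833`, route of record `HCCMUnconditional`; squad F0∕P3c∕LH4; lane
`--supports stmt-HodgeConjecture-24833 --as helper` (count-neutral; pays NO tier-0 row).  THEOREMS ONLY (no `def`, no instance, no notation, no `sorry`, default heartbeats);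
pure `ℚ`∕`ℕ` bookkeeping.  OWNER'S ORGAN №8 for the END `levels_typeTwo_censusLaw` (★ p859606's `hLaw`; dealer WORD #58 RULING A).

THE OBJECT.  ★ p859906 `toricCensusSum_ramK_weld_cut` (even `a′`) and ★∕cand `toricCensusSum_ramK_weld_cut_flip` (odd `a′`) put the G-side census difference of a level piece
`lev_{a′,b′}` on type RamK in the closed form `W(m₁, jl₁, C) = q^{m₁}(2[A]_q − 2[B]_q) − 2Σ_{a ∈ band(m₁, jl₁, C)} q^{a + ⌊jl₁∕2⌋}` at the scaled tokens `(m₁, jl₁) = (m − a′, jλ − a′)` with the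
diagonal cutoff `C = m + jλ − b′`.  THIS FILE is the arithmetic that turns `W` into the two-literal law's right-hand side (LAW-FIT memo v1∕v2 `F0/P3c/LH4/LH4-p07/g9/LAW-FIT-RamK.v1…md`,
exact on the ★ T5s tables for `q ∈ {2,3}`, `d ∈ {2,…,5}`; the closed-form identity re-checked for `q ≤ 5`, `d ≤ 7`, 1292 cases, 0 bad):
* `law_arith` — the abstract exponent identity `(x − 1)x^k(x^M(2[A] − 2[B]) − 2x^J Σ_{Ioc L U} x^a) = 2x^N(x^{P+1} − x^T)` from `M + A = J + U + 1` (the ball's top cancels the band's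
  top), `k + J + L + 1 = N + P + 1`, `k + M + B = N + T`;
* **`law_arith_sq`** (`sq_{m*} = lev(0, m*)`, also `lev_{ℓ₀,m*}` at even `d`; `(ks, bs) = (cs, cs)`), **`law_arith_levLo_odd`** (`lev_{ℓ₀,m*}`, odd `d`, `a′ = 1`, flipped lane;
  `(cs, cs)`), **`law_arith_levHi_even`** (`lev_{ℓ₀+1,m*}`, even `d`, `a′ = 1`, flipped lane; `(kl, bl)`), **`law_arith_levHi_odd`** (odd `d`, `a′ = 2`, standard lane; `(kl, bl)`):
  `(q − 1)·q^{ks}·W = 2q^m(q^{(jλ−d)∕2+1} − q^{(d − d%2) + bs})`, each from the parities, `C + m* = m + jλ`, `jl₁ ≤ C`, `C + d ≤ m₁ + jl₁ + 1`, `m₁ + 2d ≤ C + 2` by `omega` on the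
  exponents — these ARE the dealer's D-1b letters `(csOfRecord, csOfRecord)` ∕ `(klOfRecord, blOfRecord)` (★ p859562), now pinned by a Lean identity instead of a fit;
* `law_template` — with the H-side count `(q − 1)·NV = 2(q^{(jλ−d)∕2+1} − 1)` (★ (NV) p859839, LH4-p10 (g6)): `q^{−m}·W = q^{−ks}·NV + 2(q^{−ks} − q^{shiftR d + bs − ks})∕(q − 1)`, i.e.
  the digits `cA∕2 = q^{−ks}`, `cB∕2 = 2(q^{−ks} − q^{shiftR d − ks + bs})∕(q − 1)` of ★ p859606's `(a b : ℕ) (cA cB : ℂ) hLaw`.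
HONEST LABEL.  Count-neutral arithmetic; no frame, no CM place, no law asserted; `HC_CM` is proved only modulo the 7 printed citations (2 remaining named inputs: hLiu418 =
`stmt-HodgeConjecture-24832`, h413 = `stmt-HodgeConjecture-24833`) until rung 0 closes.

## References
* [Kottwitz1986BaseChangeUnits] R. E. Kottwitz, *Base change for unit elements of Hecke algebras*, Compositio Math. 60 (1986): §1 pp. 240–241 (the lattice-count form of the sides).
* [Rogawski1990] J. D. Rogawski, *Automorphic Representations of Unitary Groups in Three Variables*, Ann. of Math. Stud. 123 (1990): §4.9 Prop. 4.9.1 (b) p. 55 (the transfer identity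
  whose constants these are).
* [Flicker1998UnitaryFL] Y. Z. Flicker, *Elementary proof of the fundamental lemma for a unitary group*, Canad. J. Math. 50 (1998): Prop. 7 p. 84 (the counting recursion).
-/

set_option autoImplicit false

namespace Summit.HodgeConjecture.HodgeConjecture.Cruxes.H413.F0P3cDyRamLevelsCensusLawArithRamK

open Finset
open Summit.HodgeConjecture.HodgeConjecture.Cruxes.H413.F0P3cDyRamFourFramePieces (mstarOfRecord)
open Summit.HodgeConjecture.HodgeConjecture.Cruxes.H413.F0P3cDyRamStageOneBDefs (csOfRecord klOfRecord blOfRecord laLowOfRecord laHighOfRecord)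
open Summit.HodgeConjecture.HodgeConjecture.Cruxes.H413.F0P3cDyRamToricCensusSumRamKCut (filter_band_eq_Ioc)

/-- **THE CLOSING ARITHMETIC, ABSTRACT EXPONENTS** [cite: Rogawski1990, §4.9 Prop. 4.9.1 (b) p. 55] [cite: Kottwitz1986BaseChangeUnits, §1 pp. 240–241].  `(x − 1)·x^k·(x^M(2[A]_x − 2[B]_x) − 2x^J Σ_{a ∈ Ioc L U} x^a) = 2x^N(x^{P+1} − x^T)` whenever `M + A = J + U + 1`
(the ball's top cancels the band's top), `k + J + L + 1 = N + P + 1` and `k + M + B = N + T` (`L ≤ U`, `x ≠ 1`). -/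
theorem law_arith (x : ℚ) (hx : x ≠ 1) {k M A B J L U N P T : ℕ} (hLU : L ≤ U)
    (h1 : M + A = J + (U + 1)) (h2 : k + (J + (L + 1)) = N + (P + 1)) (h3 : k + (M + B) = N + T) :
    (x - 1) * x ^ k * (x ^ M * (2 * ∑ i ∈ range A, x ^ i - 2 * ∑ i ∈ range B, x ^ i) - 2 * x ^ J * ∑ a ∈ Ioc L U, x ^ a) =
      2 * x ^ N * (x ^ (P + 1) - x ^ T) := by
  have hx1 : x - 1 ≠ 0 := sub_ne_zero.2 hx
  have gA : (∑ i ∈ range A, x ^ i) * (x - 1) = x ^ A - 1 := geom_sum_mul x A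
  have gB : (∑ i ∈ range B, x ^ i) * (x - 1) = x ^ B - 1 := geom_sum_mul x B
  have gI : (∑ a ∈ Ioc L U, x ^ a) * (x - 1) = x ^ (U + 1) - x ^ (L + 1) := by
    rw [← Finset.Ico_add_one_add_one_eq_Ioc, geom_sum_Ico hx (by omega), div_mul_cancel₀ _ hx1]
  have e1 : x ^ M * x ^ A = x ^ J * x ^ (U + 1) := by rw [← pow_add, ← pow_add, h1]
  have e2 : x ^ k * (x ^ J * x ^ (L + 1)) = x ^ N * x ^ (P + 1) := by rw [← pow_add, ← pow_add, ← pow_add, h2]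
  have e3 : x ^ k * (x ^ M * x ^ B) = x ^ N * x ^ T := by rw [← pow_add, ← pow_add, ← pow_add, h3]
  linear_combination (2 * x ^ k * x ^ M) * gA - (2 * x ^ k * x ^ M) * gB - (2 * x ^ k * x ^ J) * gI + (2 * x ^ k) * e1 + 2 * e2 - 2 * e3


/-- `Σ_{a ∈ s} x^{a + J} = x^J·Σ_{a ∈ s} x^a`. -/
theorem sum_pow_add_eq_mul_sum (x : ℚ) (s : Finset ℕ) (J : ℕ) : ∑ a ∈ s, x ^ (a + J) = x ^ J * ∑ a ∈ s, x ^ a := by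
  rw [Finset.mul_sum]
  exact Finset.sum_congr rfl fun a _ => by rw [pow_add, mul_comm]


/-- **CLOSING ARITHMETIC, `sq_{m*}` = lev(0, m*)** (also `lev_{ℓ₀,m*}` at even `d`): `a′ = 0`, standard lane, `(ks, bs) = (cs, cs)`; `C + m* = m + jl`. [cite: Rogawski1990, §4.9 Prop. 4.9.1 (b) p. 55] [cite: Flicker1998UnitaryFL, Prop. 7 p. 84] -/
theorem law_arith_sq (q : ℕ) (hq : 2 ≤ q) {d m jl m₁ jl₁ C : ℕ} (hd : 2 ≤ d) 
    (hme : m₁ + 0 = m) (hjle : jl₁ + 0 = jl) (hjl : jl % 2 = d % 2) (hpar : m % 2 = d % 2) (hmjl : m ≤ jl)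
    (hCeq : C + mstarOfRecord d = m + jl) (hC : jl₁ ≤ C) (hCe : C + d ≤ m₁ + jl₁ + 1)
    (hfar : m₁ + 2 * d ≤ C + 2) :
    ((q : ℚ) - 1) * (q : ℚ) ^ csOfRecord d *
        ((q : ℚ) ^ m₁ * (2 * ∑ i ∈ range ((jl₁ - d) / 2 + 1), (q : ℚ) ^ i - 2 * ∑ i ∈ range (d - d % 2), (q : ℚ) ^ i) -
          2 * ∑ a ∈ (range (jl₁ + 2)).filter (fun a => a ≤ m₁ ∧ C + m₁ < jl₁ + 2 * a ∧ 2 * m₁ + 2 * d < jl₁ + 2 * a + 2 ∧ 2 * a + d ≤ 2 * m₁ + 1),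
            (q : ℚ) ^ (a + jl₁ / 2)) =
      2 * (q : ℚ) ^ m * ((q : ℚ) ^ ((jl - d) / 2 + 1) - (q : ℚ) ^ ((d - d % 2) + csOfRecord d)) := by
  have hx : (q : ℚ) ≠ 1 := by exact_mod_cast (show q ≠ 1 by omega)
  have hms : mstarOfRecord d = d % 2 + 2 * d - 1 := rfl
  have hcs : csOfRecord d = (d + 1) / 2 := rfl
  have hkl : klOfRecord d = max (d % 2 + 1) d - d / 2 + 1 := rfl
  have hbl : blOfRecord d = klOfRecord d - 2 := rfl
  rw [filter_band_eq_Ioc hd (by omega) hC hfar, sum_pow_add_eq_mul_sum, ← mul_assoc (2 : ℚ)]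
  exact law_arith (q : ℚ) hx (by omega) (by omega) (by omega) (by omega)

/-- **CLOSING ARITHMETIC, `lev_{ℓ₀,m*}` at ODD `d`**: `a′ = 1`, flipped lane at `(m₁, jl₁) = (m − 1, jl − 1)`, `(ks, bs) = (cs, cs)`. [cite: Rogawski1990, §4.9 Prop. 4.9.1 (b) p. 55] -/
theorem law_arith_levLo_odd (q : ℕ) (hq : 2 ≤ q) {d m jl m₁ jl₁ C : ℕ} (hd : 2 ≤ d) (hdo : d % 2 = 1)
    (hme : m₁ + 1 = m) (hjle : jl₁ + 1 = jl) (hjl : jl % 2 = d % 2) (hpar : m % 2 = d % 2) (hmjl : m ≤ jl)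
    (hCeq : C + mstarOfRecord d = m + jl) (hC : jl₁ ≤ C) (hCe : C + d ≤ m₁ + jl₁ + 1)
    (hfar : m₁ + 2 * d ≤ C + 2) :
    ((q : ℚ) - 1) * (q : ℚ) ^ csOfRecord d *
        ((q : ℚ) ^ m₁ * (2 * ∑ i ∈ range ((jl₁ - d + 1) / 2 + d % 2), (q : ℚ) ^ i - 2 * ∑ i ∈ range (d - 1 + d % 2), (q : ℚ) ^ i) -
          2 * ∑ a ∈ (range (jl₁ + 2)).filter (fun a => a ≤ m₁ ∧ C + m₁ < jl₁ + 2 * a ∧ 2 * m₁ + 2 * d < jl₁ + 2 * a + 2 ∧ 2 * a + d ≤ 2 * m₁ + 1),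
            (q : ℚ) ^ (a + jl₁ / 2)) =
      2 * (q : ℚ) ^ m * ((q : ℚ) ^ ((jl - d) / 2 + 1) - (q : ℚ) ^ ((d - d % 2) + csOfRecord d)) := by
  have hx : (q : ℚ) ≠ 1 := by exact_mod_cast (show q ≠ 1 by omega)
  have hms : mstarOfRecord d = d % 2 + 2 * d - 1 := rfl
  have hcs : csOfRecord d = (d + 1) / 2 := rfl
  have hkl : klOfRecord d = max (d % 2 + 1) d - d / 2 + 1 := rfl
  have hbl : blOfRecord d = klOfRecord d - 2 := rfl
  rw [filter_band_eq_Ioc hd (by omega) hC hfar, sum_pow_add_eq_mul_sum, ← mul_assoc (2 : ℚ)]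
  exact law_arith (q : ℚ) hx (by omega) (by omega) (by omega) (by omega)

/-- **CLOSING ARITHMETIC, `lev_{ℓ₀+1,m*}` at EVEN `d`**: `a′ = 1`, flipped lane, `(ks, bs) = (kl, bl)`. [cite: Rogawski1990, §4.9 Prop. 4.9.1 (b) p. 55] -/
theorem law_arith_levHi_even (q : ℕ) (hq : 2 ≤ q) {d m jl m₁ jl₁ C : ℕ} (hd : 2 ≤ d) (hde : d % 2 = 0)
    (hme : m₁ + 1 = m) (hjle : jl₁ + 1 = jl) (hjl : jl % 2 = d % 2) (hpar : m % 2 = d % 2) (hmjl : m ≤ jl)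
    (hCeq : C + mstarOfRecord d = m + jl) (hC : jl₁ ≤ C) (hCe : C + d ≤ m₁ + jl₁ + 1)
    (hfar : m₁ + 2 * d ≤ C + 2) :
    ((q : ℚ) - 1) * (q : ℚ) ^ klOfRecord d *
        ((q : ℚ) ^ m₁ * (2 * ∑ i ∈ range ((jl₁ - d + 1) / 2 + d % 2), (q : ℚ) ^ i - 2 * ∑ i ∈ range (d - 1 + d % 2), (q : ℚ) ^ i) -
          2 * ∑ a ∈ (range (jl₁ + 2)).filter (fun a => a ≤ m₁ ∧ C + m₁ < jl₁ + 2 * a ∧ 2 * m₁ + 2 * d < jl₁ + 2 * a + 2 ∧ 2 * a + d ≤ 2 * m₁ + 1),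
            (q : ℚ) ^ (a + jl₁ / 2)) =
      2 * (q : ℚ) ^ m * ((q : ℚ) ^ ((jl - d) / 2 + 1) - (q : ℚ) ^ ((d - d % 2) + blOfRecord d)) := by
  have hx : (q : ℚ) ≠ 1 := by exact_mod_cast (show q ≠ 1 by omega)
  have hms : mstarOfRecord d = d % 2 + 2 * d - 1 := rfl
  have hcs : csOfRecord d = (d + 1) / 2 := rfl
  have hkl : klOfRecord d = max (d % 2 + 1) d - d / 2 + 1 := rfl
  have hbl : blOfRecord d = klOfRecord d - 2 := rfl
  rw [filter_band_eq_Ioc hd (by omega) hC hfar, sum_pow_add_eq_mul_sum, ← mul_assoc (2 : ℚ)]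
  exact law_arith (q : ℚ) hx (by omega) (by omega) (by omega) (by omega)

/-- **CLOSING ARITHMETIC, `lev_{ℓ₀+1,m*}` at ODD `d`**: `a′ = 2`, standard lane at `(m − 2, jl − 2)`, `(ks, bs) = (kl, bl)`. [cite: Rogawski1990, §4.9 Prop. 4.9.1 (b) p. 55] -/
theorem law_arith_levHi_odd (q : ℕ) (hq : 2 ≤ q) {d m jl m₁ jl₁ C : ℕ} (hd : 2 ≤ d) (hdo : d % 2 = 1)
    (hme : m₁ + 2 = m) (hjle : jl₁ + 2 = jl) (hjl : jl % 2 = d % 2) (hpar : m % 2 = d % 2) (hmjl : m ≤ jl)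
    (hCeq : C + mstarOfRecord d = m + jl) (hC : jl₁ ≤ C) (hCe : C + d ≤ m₁ + jl₁ + 1)
    (hfar : m₁ + 2 * d ≤ C + 2) :
    ((q : ℚ) - 1) * (q : ℚ) ^ klOfRecord d *
        ((q : ℚ) ^ m₁ * (2 * ∑ i ∈ range ((jl₁ - d) / 2 + 1), (q : ℚ) ^ i - 2 * ∑ i ∈ range (d - d % 2), (q : ℚ) ^ i) -
          2 * ∑ a ∈ (range (jl₁ + 2)).filter (fun a => a ≤ m₁ ∧ C + m₁ < jl₁ + 2 * a ∧ 2 * m₁ + 2 * d < jl₁ + 2 * a + 2 ∧ 2 * a + d ≤ 2 * m₁ + 1),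
            (q : ℚ) ^ (a + jl₁ / 2)) =
      2 * (q : ℚ) ^ m * ((q : ℚ) ^ ((jl - d) / 2 + 1) - (q : ℚ) ^ ((d - d % 2) + blOfRecord d)) := by
  have hx : (q : ℚ) ≠ 1 := by exact_mod_cast (show q ≠ 1 by omega)
  have hms : mstarOfRecord d = d % 2 + 2 * d - 1 := rfl
  have hcs : csOfRecord d = (d + 1) / 2 := rfl
  have hkl : klOfRecord d = max (d % 2 + 1) d - d / 2 + 1 := rfl
  have hbl : blOfRecord d = klOfRecord d - 2 := rfl
  rw [filter_band_eq_Ioc hd (by omega) hC hfar, sum_pow_add_eq_mul_sum, ← mul_assoc (2 : ℚ)]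
  exact law_arith (q : ℚ) hx (by omega) (by omega) (by omega) (by omega)


/-- **THE LAW TEMPLATE.**  From the closing arithmetic `(x − 1)·x^k·V = 2x^m(R − x^T)` and the H-side count `(x − 1)·NV = 2(R − 1)` (★ (NV), LH4-p10 (g6)):
`x^{−m}·V = x^{−k}·NV + 2(x^{−k} − x^T·x^{−k})∕(x − 1)` — the digits `cA∕2 = q^{−ks}`, `cB∕2 = 2(q^{−ks} − q^{shiftR + bs − ks})∕(q − 1)` of the two-literal law. [cite: Rogawski1990, §4.9 Prop. 4.9.1 (b) p. 55] -/
theorem law_template (x : ℚ) (hx1 : x ≠ 1) (hx0 : x ≠ 0) {k m T : ℕ} {V NV R : ℚ}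
    (hV : (x - 1) * x ^ k * V = 2 * x ^ m * (R - x ^ T)) (hNV : (x - 1) * NV = 2 * (R - 1)) :
    (x ^ m)⁻¹ * V = (x ^ k)⁻¹ * NV + 2 * ((x ^ k)⁻¹ - x ^ T * (x ^ k)⁻¹) / (x - 1) := by
  have hx1' : x - 1 ≠ 0 := sub_ne_zero.2 hx1
  have hk : x ^ k ≠ 0 := pow_ne_zero _ hx0
  have hm : x ^ m ≠ 0 := pow_ne_zero _ hx0
  field_simp
  linear_combination hV - x ^ m * hNV

end Summit.HodgeConjecture.HodgeConjecture.Cruxes.H413.F0P3cDyRamLevelsCensusLawArithRamK
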